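import Summits.CriticalPhenomena.PercolationContinuityZ3.Theorems.PercNearOneGluingNoHeavyLowerTailTieLocusCorner
import HarnessLib

/-!
# `Q44b` for every finite weighted graph from pencil-concavity at the terminal `a` (the reduction)

Support file for crux `stmt-CriticalPhenomena-4575` (master-family programme, quadratic four-point row `Q44b` of
`prim-bnk-1` gen 13, OPEN for all `n`), seat `prim-l12-p6` gen 7; memo
`run/shared/lean/prim/prim-l12/FROM-prim-l12-p6-g7-Q44B-PENCIL-CONCAVITY.md` §1.

Bond percolation `μ_w = prodBernoulli w` on the pairs of `Fin n`, four vertices `a b c y`.  With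
`P(π)` the probability that the open clusters induce the partition `π` of `{a,b,c,y}` (`∅ = a|b|c|y`),
the row is `Q44b(w) = P(AC)P(∅) − P(AΔ)P(X) − P(ab|c|y)P(C¬A) − P(a|bcy)P(X′)` with
`AC = {a~b ∧ c~y}`, `AΔ = {ab|cy, ab|c|y}`, `X = {ac|by, ay|bc}`, `C¬A = {c~y ∧ a≁b}`, `X′ = {ac|b|y, ay|b|c}`
(`Q44b.row`; its bilinear form in two weightings is `Q44b.bil`).

* `Q44b.pencil_step` — along the one-bond pencil of a pair `e` the row is the quadratic
  `(1−t)²B₀ + t(1−t)(B₀₁+B₁₀) + t²B₂` (`t = w e`; `real_oneBond` for the eight events); if it is CONCAVE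
  (`Q44b.PencilConcave w e : B₀ + B₂ ≤ B₀₁ + B₁₀`) and nonnegative at the two ends `w[e↦0]`, `w[e↦1]`, it is
  nonnegative at `w`.
* `Q44b.row_eq_zero_of_frozen` — if every pair at a vertex surely joined to `a` (by weight-one pairs) has
  weight `0` or `1`, the cluster of `a` is deterministic and `Q44b(w) = 0` (every product has a vanishing
  factor).
* `Q44b.row_nonneg_of_pencilConcave` — **the reduction**: if the pencil of every pair `s(x,z)` with `x`
  surely joined to `a` in `w[s(x,z)↦0]` is concave (`Q44b.NDa`, the 5-point condition 'ND_a' of the memo;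
  numerically exact on > 10⁴ instances, its `z = b` case is `Q44bExchange.crossPendant_exchange_sum`), then
  `0 ≤ Q44b(w)` for every weighting `w` — by induction on the number of pairs with weight in `(0,1)`.

Definitions (`row`, `bil`, `PencilConcave`, `sureJoined`, `NDa`) and theorems; no named facts, no sorries,
standard axioms.
-/

noncomputable section

namespace Summit.CriticalPhenomena.PercolationContinuityZ3.Theorems

namespace Q44b

open MeasureTheory Set Literature.Probability.LatticeModels Literature.Probability.Percolation
open scoped Classical

variable {n : ℕ}

/-! ### The eight events of the row and its bilinear form -/

/-- `AC = {a~b ∧ c~y}`. [this work] -/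
def evAC (a b c y : Fin n) : Set (BondConfig (Fin n)) := openConn a b ∩ openConn c y
/-- `∅ = {a,b,c,y pairwise separated}`. [this work] -/
def evEmp (a b c y : Fin n) : Set (BondConfig (Fin n)) :=
  (openConn a b)ᶜ ∩ (openConn a c)ᶜ ∩ (openConn a y)ᶜ ∩ (openConn b c)ᶜ ∩ (openConn b y)ᶜ ∩ (openConn c y)ᶜ
/-- `AΔ = {ab|cy, ab|c|y} = {a~b, a≁c, a≁y}`. [this work] -/
def evAD (a b c y : Fin n) : Set (BondConfig (Fin n)) := openConn a b ∩ (openConn a c)ᶜ ∩ (openConn a y)ᶜ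
/-- `X = {ac|by, ay|bc} = {a≁b} ∩ ((a~c ∧ b~y) ∪ (a~y ∧ b~c))`. [this work] -/
def evX (a b c y : Fin n) : Set (BondConfig (Fin n)) :=
  (openConn a b)ᶜ ∩ (openConn a c ∩ openConn b y ∪ openConn a y ∩ openConn b c)
/-- `ab|c|y = {a~b, a≁c, a≁y, c≁y}`. [this work] -/
def evAB (a b c y : Fin n) : Set (BondConfig (Fin n)) :=
  openConn a b ∩ (openConn a c)ᶜ ∩ (openConn a y)ᶜ ∩ (openConn c y)ᶜ
/-- `C¬A = {c~y ∧ a≁b}`. [this work] -/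
def evCnA (a b c y : Fin n) : Set (BondConfig (Fin n)) := openConn c y ∩ (openConn a b)ᶜ
/-- `a|bcy = {a≁b, a≁c, a≁y, b~c, b~y}`. [this work] -/
def evPend (a b c y : Fin n) : Set (BondConfig (Fin n)) :=
  (openConn a b)ᶜ ∩ (openConn a c)ᶜ ∩ (openConn a y)ᶜ ∩ openConn b c ∩ openConn b y
/-- `X′ = {ac|b|y, ay|b|c} = {a≁b} ∩ ((a~c ∧ a≁y ∧ b≁y) ∪ (a~y ∧ a≁c ∧ b≁c))`. [this work] -/
def evXp (a b c y : Fin n) : Set (BondConfig (Fin n)) :=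
  (openConn a b)ᶜ ∩ (openConn a c ∩ (openConn a y)ᶜ ∩ (openConn b y)ᶜ ∪
    openConn a y ∩ (openConn a c)ᶜ ∩ (openConn b c)ᶜ)

/-- The bilinear form of the row in two weightings (copy 1 under `w`, copy 2 under `w'`):
`P_w(AC)P_{w'}(∅) − P_w(AΔ)P_{w'}(X) − P_w(ab|c|y)P_{w'}(C¬A) − P_w(a|bcy)P_{w'}(X′)`. [this work] -/
def bil (w w' : Sym2 (Fin n) → unitInterval) (a b c y : Fin n) : ℝ :=
  (prodBernoulli w).real (evAC a b c y) * (prodBernoulli w').real (evEmp a b c y) -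
    (prodBernoulli w).real (evAD a b c y) * (prodBernoulli w').real (evX a b c y) -
    (prodBernoulli w).real (evAB a b c y) * (prodBernoulli w').real (evCnA a b c y) -
    (prodBernoulli w).real (evPend a b c y) * (prodBernoulli w').real (evXp a b c y)

/-- The row `Q44b(w) = bil w w`. [this work] -/
def row (w : Sym2 (Fin n) → unitInterval) (a b c y : Fin n) : ℝ := bil w w a b c y

/-- **Pencil concavity of the row along the pair `e`**: `B₀ + B₂ ≤ B₀₁ + B₁₀` for the end weightings
`w[e↦0]`, `w[e↦1]` (equivalently: `t ↦ Q44b(w[e↦t])` is concave on `[0,1]`). [this work] -/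
def PencilConcave (w : Sym2 (Fin n) → unitInterval) (e : Sym2 (Fin n)) (a b c y : Fin n) : Prop :=
  bil (Function.update w e 0) (Function.update w e 0) a b c y +
      bil (Function.update w e 1) (Function.update w e 1) a b c y ≤
    bil (Function.update w e 0) (Function.update w e 1) a b c y +
      bil (Function.update w e 1) (Function.update w e 0) a b c y

/-- `x` is surely joined to `a`: joined by a path of weight-one pairs. [this work] -/
def sureJoined (w : Sym2 (Fin n) → unitInterval) (a x : Fin n) : Prop :=
  (SimpleGraph.fromEdgeSet {e : Sym2 (Fin n) | w e = 1}).Reachable a x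

/-- **Hypothesis `ND_a`** (memo §1–§2): for every weighting and every pair `s(x,z)` whose end `x` is surely
joined to `a` after the pair is deleted, the pencil of the row along `s(x,z)` is concave.  In graph language:
`Q44b` is concave along the one-bond pencil of every edge at the terminal `a` (of the graph with `a`'s sure
cluster contracted). [this work] -/
def NDa (n : ℕ) (a b c y : Fin n) : Prop :=
  ∀ (w : Sym2 (Fin n) → unitInterval) (x z : Fin n), x ≠ z →
    sureJoined (Function.update w s(x, z) 0) a x → PencilConcave w s(x, z) a b c y

/-! ### The pencil step -/

/-- One-bond expansion of the bilinear form: with `t = w e`, `w₀ = w[e↦0]`, `w₁ = w[e↦1]`,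
`Q44b(w) = (1−t)²B(w₀,w₀) + (1−t)t B(w₀,w₁) + t(1−t) B(w₁,w₀) + t² B(w₁,w₁)`. [this work] -/
theorem row_oneBond (w : Sym2 (Fin n) → unitInterval) (e : Sym2 (Fin n)) (a b c y : Fin n) :
    row w a b c y =
      (1 - (w e : ℝ)) * (1 - (w e : ℝ)) * bil (Function.update w e 0) (Function.update w e 0) a b c y +
        (1 - (w e : ℝ)) * (w e : ℝ) * bil (Function.update w e 0) (Function.update w e 1) a b c y +
        (w e : ℝ) * (1 - (w e : ℝ)) * bil (Function.update w e 1) (Function.update w e 0) a b c y +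
        (w e : ℝ) * (w e : ℝ) * bil (Function.update w e 1) (Function.update w e 1) a b c y := by
  unfold row bil
  rw [TieLocus.real_oneBond w e (evAC a b c y), TieLocus.real_oneBond w e (evEmp a b c y),
    TieLocus.real_oneBond w e (evAD a b c y), TieLocus.real_oneBond w e (evX a b c y),
    TieLocus.real_oneBond w e (evAB a b c y), TieLocus.real_oneBond w e (evCnA a b c y),
    TieLocus.real_oneBond w e (evPend a b c y), TieLocus.real_oneBond w e (evXp a b c y)]
  ring

/-- **Pencil step**: a quadratic `(1−t)²B₀ + t(1−t)(B₀₁+B₁₀) + t²B₂` on `[0,1]` with `B₀, B₂ ≥ 0` and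
`B₀ + B₂ ≤ B₀₁ + B₁₀` is `≥ (1−t)B₀ + tB₂ ≥ 0`; hence `0 ≤ Q44b(w)` from the two ends and pencil concavity. [this work] -/
theorem pencil_step (w : Sym2 (Fin n) → unitInterval) (e : Sym2 (Fin n)) (a b c y : Fin n)
    (h0 : 0 ≤ row (Function.update w e 0) a b c y) (h1 : 0 ≤ row (Function.update w e 1) a b c y)
    (hc : PencilConcave w e a b c y) : 0 ≤ row w a b c y := by
  rw [row_oneBond w e]
  unfold row at h0 h1
  unfold PencilConcave at hc
  set t : ℝ := (w e : ℝ)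
  have ht0 : 0 ≤ t := unitInterval.nonneg (w e)
  have ht1 : t ≤ 1 := unitInterval.le_one (w e)
  set B0 := bil (Function.update w e 0) (Function.update w e 0) a b c y
  set B2 := bil (Function.update w e 1) (Function.update w e 1) a b c y
  set B01 := bil (Function.update w e 0) (Function.update w e 1) a b c y
  set B10 := bil (Function.update w e 1) (Function.update w e 0) a b c y
  have key : (1 - t) * B0 + t * B2 ≤
      (1 - t) * (1 - t) * B0 + (1 - t) * t * B01 + t * (1 - t) * B10 + t * t * B2 := by
    have : (1 - t) * t * (B0 + B2) ≤ (1 - t) * t * (B01 + B10) :=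
      mul_le_mul_of_nonneg_left hc (mul_nonneg (by linarith) ht0)
    nlinarith
  have : 0 ≤ (1 - t) * B0 + t * B2 := by positivity
  linarith

/-! ### Frozen cluster of `a`: the row vanishes -/

/-- Weight-one pairs along a sure path are almost surely open, so a surely joined vertex is almost surely
joined. [folklore] -/
theorem ae_reachable_of_sureJoined (w : Sym2 (Fin n) → unitInterval) (a x : Fin n)
    (h : sureJoined w a x) : ∀ᵐ ω ∂(prodBernoulli w), (openGraph ω).Reachable a x := by
  have h1 : ∀ᵐ ω ∂(prodBernoulli w), ∀ e : Sym2 (Fin n), w e = 1 → e ∈ ω := by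
    rw [ae_all_iff]
    intro e
    by_cases he : w e = 1
    · filter_upwards [prodBernoulli_ae_mem_of_eq_one w he] with ω hω
      exact fun _ => hω
    · exact Filter.Eventually.of_forall fun ω h' => absurd h' he
  filter_upwards [h1] with ω hω
  refine h.mono ?_
  intro u v huv
  rw [SimpleGraph.fromEdgeSet_adj] at huv
  exact (openGraph_adj ω u v).2 ⟨hω _ huv.1, huv.2⟩

/-- Surely joined vertices are joined with probability one. [folklore] -/
theorem real_openConn_eq_one_of_sureJoined (w : Sym2 (Fin n) → unitInterval) (a x : Fin n)
    (h : sureJoined w a x) : (prodBernoulli w).real (openConn a x) = 1 := by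
  rw [← probReal_univ (μ := prodBernoulli w)]
  refine measureReal_congr ?_
  filter_upwards [ae_reachable_of_sureJoined w a x h] with ω hω
  exact propext (iff_of_true hω (mem_univ ω))

/-- **Frozen cluster.**  If every pair `s(x,z)` (`x ≠ z`) at a vertex `x` surely joined to `a` has weight `0` or
`1`, then almost surely the open cluster of `a` is exactly the set of surely joined vertices: an open path
leaving it would have to use a pair at a surely joined vertex that is open but not of weight one, hence of
weight zero. [folklore] -/
theorem ae_reachable_iff_sureJoined (w : Sym2 (Fin n) → unitInterval) (a : Fin n)
    (hfro : ∀ x z : Fin n, x ≠ z → sureJoined w a x → (w s(x, z) = 0 ∨ w s(x, z) = 1)) (t : Fin n) :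
    ∀ᵐ ω ∂(prodBernoulli w), ((openGraph ω).Reachable a t ↔ sureJoined w a t) := by
  have h1 : ∀ᵐ ω ∂(prodBernoulli w), ∀ e : Sym2 (Fin n), w e = 1 → e ∈ ω := by
    rw [ae_all_iff]
    intro e
    by_cases he : w e = 1
    · filter_upwards [prodBernoulli_ae_mem_of_eq_one w he] with ω hω
      exact fun _ => hω
    · exact Filter.Eventually.of_forall fun ω h' => absurd h' he
  have h0 : ∀ᵐ ω ∂(prodBernoulli w), ∀ e : Sym2 (Fin n), w e = 0 → e ∉ ω := by
    rw [ae_all_iff]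
    intro e
    by_cases he : w e = 0
    · filter_upwards [prodBernoulli_ae_notMem w he] with ω hω
      exact fun _ => hω
    · exact Filter.Eventually.of_forall fun ω h' => absurd h' he
  filter_upwards [h1, h0] with ω hω1 hω0
  constructor
  · intro hreach
    by_contra hnot
    obtain ⟨p⟩ := hreach
    obtain ⟨d, -, hdS, hdnS⟩ :=
      p.exists_boundary_dart {x | sureJoined w a x} (SimpleGraph.Reachable.refl a) hnot
    have hadj := (openGraph_adj ω d.fst d.snd).1 d.adj
    -- the boundary pair is open, hence not of weight zero; it sits at a surely joined vertex, hence of weight one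
    have hw1 : w s(d.fst, d.snd) = 1 := by
      rcases hfro d.fst d.snd hadj.2 hdS with h | h
      · exact absurd hadj.1 (hω0 _ h)
      · exact h
    apply hdnS
    exact SimpleGraph.Reachable.trans hdS
      (SimpleGraph.Adj.reachable ((SimpleGraph.fromEdgeSet_adj _).2 ⟨hw1, hadj.2⟩))
  · intro hsure
    refine hsure.mono ?_
    intro u v huv
    rw [SimpleGraph.fromEdgeSet_adj] at huv
    exact (openGraph_adj ω u v).2 ⟨hω1 _ huv.1, huv.2⟩

/-- Under a frozen cluster, `P(a ~ t)` is `0` or `1` for every `t`. [folklore] -/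
theorem real_openConn_zero_or_one (w : Sym2 (Fin n) → unitInterval) (a : Fin n)
    (hfro : ∀ x z : Fin n, x ≠ z → sureJoined w a x → (w s(x, z) = 0 ∨ w s(x, z) = 1)) (t : Fin n) :
    (prodBernoulli w).real (openConn a t) = 0 ∨ (prodBernoulli w).real (openConn a t) = 1 := by
  by_cases ht : sureJoined w a t
  · exact Or.inr (real_openConn_eq_one_of_sureJoined w a t ht)
  · left
    rw [← measureReal_empty (μ := prodBernoulli w)]
    refine measureReal_congr ?_
    filter_upwards [ae_reachable_iff_sureJoined w a hfro t] with ω hω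
    exact propext (iff_of_false (fun h => ht (hω.1 h)) (notMem_empty ω))

/-- An event inside `{a ~ t}` is null when `P(a~t) = 0`; an event inside `{a ≁ t}` is null when `P(a~t) = 1`.
[folklore] -/
theorem real_eq_zero_of_subset (w : Sym2 (Fin n) → unitInterval) {E F : Set (BondConfig (Fin n))}
    (hEF : E ⊆ F) (hF : (prodBernoulli w).real F = 0) : (prodBernoulli w).real E = 0 :=
  le_antisymm (hF ▸ measureReal_mono hEF) measureReal_nonneg

/-- Complement rule `P(Fᶜ) = 1 − P(F)` on the finite configuration space. [folklore] -/
theorem real_compl (w : Sym2 (Fin n) → unitInterval) (F : Set (BondConfig (Fin n))) :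
    (prodBernoulli w).real Fᶜ = 1 - (prodBernoulli w).real F := by
  have h := measureReal_add_measureReal_compl (μ := prodBernoulli w) (s := F) MeasurableSet.of_discrete
  rw [probReal_univ] at h
  linarith

/-- **The row vanishes on a frozen cluster**: if `P(a~b), P(a~c), P(a~y) ∈ {0,1}` then every one of the four
products of `Q44b` has a vanishing factor. [this work] -/
theorem row_eq_zero_of_zero_one (w : Sym2 (Fin n) → unitInterval) (a b c y : Fin n)
    (hb : (prodBernoulli w).real (openConn a b) = 0 ∨ (prodBernoulli w).real (openConn a b) = 1)
    (hc : (prodBernoulli w).real (openConn a c) = 0 ∨ (prodBernoulli w).real (openConn a c) = 1)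
    (hy : (prodBernoulli w).real (openConn a y) = 0 ∨ (prodBernoulli w).real (openConn a y) = 1) :
    row w a b c y = 0 := by
  unfold row bil
  -- complements of probability-one events are null
  have cb : (prodBernoulli w).real (openConn a b) = 1 → (prodBernoulli w).real (openConn a b)ᶜ = 0 :=
    fun h => by rw [real_compl, h]; ring
  have cc : (prodBernoulli w).real (openConn a c) = 1 → (prodBernoulli w).real (openConn a c)ᶜ = 0 :=
    fun h => by rw [real_compl, h]; ring
  have cy' : (prodBernoulli w).real (openConn a y) = 1 → (prodBernoulli w).real (openConn a y)ᶜ = 0 :=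
    fun h => by rw [real_compl, h]; ring
  -- product 1,2,3: split on `P(a~b)`
  have p123 : (prodBernoulli w).real (evAC a b c y) * (prodBernoulli w).real (evEmp a b c y) = 0 ∧
      (prodBernoulli w).real (evAD a b c y) * (prodBernoulli w).real (evX a b c y) = 0 ∧
      (prodBernoulli w).real (evAB a b c y) * (prodBernoulli w).real (evCnA a b c y) = 0 := by
    rcases hb with h | h
    · have e1 : (prodBernoulli w).real (evAC a b c y) = 0 :=
        real_eq_zero_of_subset w (fun ω hω => hω.1) h
      have e2 : (prodBernoulli w).real (evAD a b c y) = 0 :=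
        real_eq_zero_of_subset w (fun ω hω => hω.1.1) h
      have e3 : (prodBernoulli w).real (evAB a b c y) = 0 :=
        real_eq_zero_of_subset w (fun ω hω => hω.1.1.1) h
      rw [e1, e2, e3]; simp
    · have h' := cb h
      have e1 : (prodBernoulli w).real (evEmp a b c y) = 0 :=
        real_eq_zero_of_subset w (fun ω hω => hω.1.1.1.1.1) h'
      have e2 : (prodBernoulli w).real (evX a b c y) = 0 :=
        real_eq_zero_of_subset w (fun ω hω => hω.1) h'
      have e3 : (prodBernoulli w).real (evCnA a b c y) = 0 :=
        real_eq_zero_of_subset w (fun ω hω => hω.2) h'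
      rw [e1, e2, e3]; simp
  -- product 4: `P(a|bcy) P(X′)`
  have p4 : (prodBernoulli w).real (evPend a b c y) * (prodBernoulli w).real (evXp a b c y) = 0 := by
    rcases hb with h | h
    · rcases hc with h2 | h2
      · rcases hy with h3 | h3
        · -- a isolated from b, c, y almost surely: `X′ ⊆ {a~c} ∪ {a~y}` is null
          have e : (prodBernoulli w).real (evXp a b c y) = 0 := by
            refine le_antisymm ?_ measureReal_nonneg
            calc (prodBernoulli w).real (evXp a b c y)
                ≤ (prodBernoulli w).real (openConn a c ∪ openConn a y) :=
                  measureReal_mono fun ω hω => by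
                    rcases hω.2 with h' | h'
                    · exact Or.inl h'.1.1
                    · exact Or.inr h'.1.1
              _ ≤ (prodBernoulli w).real (openConn a c) + (prodBernoulli w).real (openConn a y) :=
                  measureReal_union_le _ _
              _ = 0 := by rw [h2, h3]; ring
          rw [e]; simp
        · have e : (prodBernoulli w).real (evPend a b c y) = 0 :=
            real_eq_zero_of_subset w (fun ω hω => hω.1.1.2) (cy' h3)
          rw [e]; simp
      · have e : (prodBernoulli w).real (evPend a b c y) = 0 :=
          real_eq_zero_of_subset w (fun ω hω => hω.1.1.1.2) (cc h2)
        rw [e]; simp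
    · have e : (prodBernoulli w).real (evPend a b c y) = 0 :=
        real_eq_zero_of_subset w (fun ω hω => hω.1.1.1.1) (cb h)
      rw [e]; simp
  obtain ⟨e1, e2, e3⟩ := p123
  linarith

/-- **Frozen cluster ⇒ `Q44b = 0`.** [this work] -/
theorem row_eq_zero_of_frozen (w : Sym2 (Fin n) → unitInterval) (a b c y : Fin n)
    (hfro : ∀ x z : Fin n, x ≠ z → sureJoined w a x → (w s(x, z) = 0 ∨ w s(x, z) = 1)) :
    row w a b c y = 0 :=
  row_eq_zero_of_zero_one w a b c y (real_openConn_zero_or_one w a hfro b)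
    (real_openConn_zero_or_one w a hfro c) (real_openConn_zero_or_one w a hfro y)

/-! ### The induction on the number of fractional pairs -/

/-- The fractional pairs of a weighting. [this work] -/
def fracPairs (w : Sym2 (Fin n) → unitInterval) : Finset (Sym2 (Fin n)) :=
  Finset.univ.filter fun e => w e ≠ 0 ∧ w e ≠ 1

/-- Setting a fractional pair to an end value removes it from the fractional pairs and changes no other. [folklore] -/
theorem fracPairs_update_ssubset (w : Sym2 (Fin n) → unitInterval) {e : Sym2 (Fin n)}
    (he : w e ≠ 0 ∧ w e ≠ 1) (v : unitInterval) (hv : v = 0 ∨ v = 1) :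
    fracPairs (Function.update w e v) ⊂ fracPairs w := by
  rw [Finset.ssubset_iff_subset_ne]
  constructor
  · intro f hf
    simp only [fracPairs, Finset.mem_filter, Finset.mem_univ, true_and] at hf ⊢
    by_cases hfe : f = e
    · subst hfe
      rw [Function.update_self] at hf
      rcases hv with rfl | rfl
      · exact absurd rfl hf.1
      · exact absurd rfl hf.2
    · rwa [Function.update_of_ne hfe] at hf
  · intro hEq
    have : e ∈ fracPairs (Function.update w e v) := by
      rw [hEq]
      simp only [fracPairs, Finset.mem_filter, Finset.mem_univ, true_and]
      exact he
    simp only [fracPairs, Finset.mem_filter, Finset.mem_univ, true_and, Function.update_self] at this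
    rcases hv with rfl | rfl
    · exact this.1 rfl
    · exact this.2 rfl

/-- Weight-one pairs are unchanged when a pair that is not of weight one is set to `0`; so sure joins persist. [folklore] -/
theorem sureJoined_update_zero (w : Sym2 (Fin n) → unitInterval) {e : Sym2 (Fin n)} (he : w e ≠ 1)
    {a x : Fin n} (h : sureJoined w a x) : sureJoined (Function.update w e 0) a x := by
  refine h.mono (SimpleGraph.fromEdgeSet_mono ?_)
  intro f hf
  simp only [mem_setOf_eq] at hf ⊢
  by_cases hfe : f = e
  · subst hfe; exact absurd hf he
  · rwa [Function.update_of_ne hfe]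

/-- **The reduction.**  `ND_a` (pencil concavity of `Q44b` along every pair at a vertex surely joined to `a`)
implies `0 ≤ Q44b(w)` for every weighting `w` on the pairs of `Fin n`: induction on the number of pairs with
weight in `(0,1)`; a fractional pair at `a`'s sure cluster is resolved by `pencil_step`, and when none is left
the cluster of `a` is frozen and the row vanishes (`row_eq_zero_of_frozen`). [this work] -/
theorem row_nonneg_of_pencilConcave (a b c y : Fin n) (hND : NDa n a b c y)
    (w : Sym2 (Fin n) → unitInterval) : 0 ≤ row w a b c y := by
  -- strong induction on the number of fractional pairs
  suffices H : ∀ (k : ℕ) (w : Sym2 (Fin n) → unitInterval), (fracPairs w).card ≤ k → 0 ≤ row w a b c y from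
    H _ w le_rfl
  intro k
  induction k with
  | zero =>
    intro w hw
    have hfro : ∀ x z : Fin n, x ≠ z → sureJoined w a x → (w s(x, z) = 0 ∨ w s(x, z) = 1) := by
      intro x z _ _
      by_contra hne
      push Not at hne
      have : s(x, z) ∈ fracPairs w := by
        simp only [fracPairs, Finset.mem_filter, Finset.mem_univ, true_and]; exact hne
      have hpos : 0 < (fracPairs w).card := Finset.card_pos.2 ⟨_, this⟩
      omega
    exact (row_eq_zero_of_frozen w a b c y hfro).symm.le
  | succ k ih =>
    intro w hw
    by_cases hex : ∃ x z : Fin n, x ≠ z ∧ sureJoined w a x ∧ (w s(x, z) ≠ 0 ∧ w s(x, z) ≠ 1)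
    · obtain ⟨x, z, hxz, hsure, hfrac⟩ := hex
      have hlt0 := Finset.card_lt_card (fracPairs_update_ssubset w hfrac 0 (Or.inl rfl))
      have hlt1 := Finset.card_lt_card (fracPairs_update_ssubset w hfrac 1 (Or.inr rfl))
      have h0 : 0 ≤ row (Function.update w s(x, z) 0) a b c y := ih _ (by omega)
      have h1 : 0 ≤ row (Function.update w s(x, z) 1) a b c y := ih _ (by omega)
      exact pencil_step w s(x, z) a b c y h0 h1
        (hND w x z hxz (sureJoined_update_zero w hfrac.2 hsure))
    · push Not at hex
      have hfro : ∀ x z : Fin n, x ≠ z → sureJoined w a x → (w s(x, z) = 0 ∨ w s(x, z) = 1) := by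
        intro x z hxz hs
        by_cases h0 : w s(x, z) = 0
        · exact Or.inl h0
        · exact Or.inr (hex x z hxz hs h0)
      exact (row_eq_zero_of_frozen w a b c y hfro).symm.le

end Q44b

end Summit.CriticalPhenomena.PercolationContinuityZ3.Theorems

end
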